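import Summits.AnomalousDissipation.AnomalousDissipation.Statement
import Literature.Analysis.FluidPDE.LerayHopfGalileanTorus
import Literature.Analysis.FluidPDE.DoeringFoiasPowerProofs

/-!
# Solo (blind) — Galilean covariance of the weak Navier–Stokes formulation for UNIFORMLY SWEPT forces

First of three files closing the momentum leaf `ZerothLaw ↔ TranslatingZerothLaw₀'`
(`SoloBlindSweptGalilean`, `SoloBlindGalileanLeafIff`). The tree's
`Torus.IsWeakNSSolutionForcedOn.galilean_unboost` changes frame along a weak solution driven by a STEADY
smooth force `f`, producing the swept force `(t, y) ↦ f (y + [tV])`; to undo a sweeping one needs the same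
covariance with a swept force as INPUT. Two-velocity form proved here
(`isWeakNSSolutionForcedOn_galilean_swept`): if `u` is a forced weak solution on `T^d × [0, T)` with datum
`u₀ ∈ L¹` and the force `(t, y) ↦ f (y + [tW])` (`f` smooth), then for every constant velocity `V` the field
`(t, y) ↦ u t (y + [tV]) − V` is a forced weak solution with datum `u₀ − V` and the force
`(t, y) ↦ f (y + [t(W + V)])`. `W = 0` is the tree lemma; `V = −W` returns to the steady force.

The proof is the tree's (test the identity of `u` with the transported field `ψ(t, · − [tV])`, slice identity
`Torus.integral_galilean_slice`, frame term `∫∫⟪V, ∂ₜψ⟫ = −∫⟪V, ψ 0⟫`), the force slice at time `t` being the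
smooth field `f (· + [tW])`, whose space–time lift is continuous (`aestronglyMeasurable_stLift_swept`) with
finite mass (`lintegral_Ioo_lintegral_enorm_sq_swept_lt_top`), plus the pattern identity
`f (y + [tV] + [tW]) = f (y + [t(W + V)])` (`proj` is additive).

[cite: Frisch1995, §2.2 (Galilean invariance of Navier–Stokes on the periodic box)] [folklore]
-/

noncomputable section

open MeasureTheory Set Filter Topology
open scoped InnerProductSpace RealInnerProductSpace ENNReal NNReal ContDiff

namespace Summit.AnomalousDissipation.AnomalousDissipation.Theorems

open Literature.Analysis.FunctionSpaces Literature.Analysis.FunctionSpaces.Torus UnitAddTorus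
open Literature.Analysis.FluidPDE Literature.Analysis.FluidPDE.Torus

variable {d : Type*} [Fintype d] [DecidableEq d]

/-! ### The swept force: pattern identity, measurability, mass, zero mean -/

omit [Fintype d] [DecidableEq d] in
/-- **Pattern identity**: `f (y + [tV] + [tW]) = f (y + [t(W + V)])` (`proj` is additive). [folklore] -/
theorem comp_add_proj_smul_add_proj_smul {F : Type*} (f : UnitAddTorus d → F) (W V : EuclideanSpace ℝ d)
    (t : ℝ) (y : UnitAddTorus d) :
    f (y + proj (t • V) + proj (t • W)) = f (y + proj (t • (W + V))) := by
  rw [smul_add, proj_add, add_assoc, add_comm (proj (t • V))]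

omit [DecidableEq d] in
/-- The space–time lift of a uniformly swept continuous pattern `(t, y) ↦ f (y + [tW])` is continuous,
hence a.e. strongly measurable for every measure. [folklore] -/
theorem aestronglyMeasurable_stLift_swept {f : UnitAddTorus d → EuclideanSpace ℝ d} (hf : Continuous f)
    (W : EuclideanSpace ℝ d) (μ : Measure (ℝ × EuclideanSpace ℝ d)) :
    AEStronglyMeasurable (stLift fun t y => f (y + proj (t • W))) μ := by
  have heq : (stLift fun t y => f (y + proj (t • W))) =
      fun p : ℝ × EuclideanSpace ℝ d => f (proj (p.2 + p.1 • W)) := by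
    funext p
    simp only [stLift, proj_add]
  rw [heq]
  exact (hf.comp (continuous_proj.comp (continuous_snd.add (continuous_fst.smul continuous_const)))).aestronglyMeasurable

omit [DecidableEq d] in
/-- A uniformly swept `L²` pattern has finite space–time `L²` mass on every `(0, T) × T^d`
(Haar invariance slice by slice). [folklore] -/
theorem lintegral_Ioo_lintegral_enorm_sq_swept_lt_top {f : UnitAddTorus d → EuclideanSpace ℝ d}
    (hf : MemLp f 2 volume) (W : EuclideanSpace ℝ d) (T : ℝ) :
    ∫⁻ t in Ioo (0 : ℝ) T, ∫⁻ y, ‖f (y + proj (t • W))‖ₑ ^ 2 < ⊤ := by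
  have h : ∀ t : ℝ, ∫⁻ y, ‖f (y + proj (t • W))‖ₑ ^ 2 = ∫⁻ y, ‖f y‖ₑ ^ 2 := fun t =>
    lintegral_add_right_eq_self (μ := (volume : Measure (UnitAddTorus d))) (fun y => ‖f y‖ₑ ^ 2) _
  simp_rw [h]
  exact lintegral_Ioo_lintegral_enorm_sq_steady_lt_top hf T

omit [DecidableEq d] in
/-- A translate of a mean-zero field has zero mean. [folklore] -/
theorem hasZeroMean_comp_add_right {f : UnitAddTorus d → EuclideanSpace ℝ d} (hf0 : HasZeroMean f)
    (a : UnitAddTorus d) : HasZeroMean (fun y => f (y + a)) := by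
  show ∫ y, f (y + a) = 0
  rw [integral_add_right_eq_self f a]
  exact hf0

omit [DecidableEq d] in
/-- The slices of a swept force pair to zero with constants: `∫ ⟪f (· + a), e⟫ = 0` for a mean-zero
integrable `f`. [folklore] -/
theorem integral_inner_comp_add_right_const_eq_zero {f : UnitAddTorus d → EuclideanSpace ℝ d}
    (hf : Integrable f volume) (hf0 : HasZeroMean f) (a : UnitAddTorus d) (e : EuclideanSpace ℝ d) :
    ∫ y, ⟪f (y + a), e⟫ = 0 := by
  rw [integral_add_right_eq_self (fun y => ⟪f y, e⟫) a]
  have hc : (fun y => ⟪f y, e⟫) = fun y => ⟪e, f y⟫ := funext fun y => real_inner_comm _ _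
  rw [hc, integral_inner hf e, show (∫ y, f y) = 0 from hf0, inner_zero_right]

/-! ### The weak formulation in the moving frame, swept force -/

/-- **Galilean covariance of forced weak Navier–Stokes solutions on `T^d`, uniformly swept force.**
If `u` is a forced weak solution on `T^d × [0, T)` with datum `u₀ ∈ L¹` and the force
`(t, y) ↦ f (y + [tW])` (`f` smooth, swept at the constant velocity `W`), then for every constant
velocity `V` the field `(t, y) ↦ u t (y + [tV]) - V` is a forced weak solution on `T^d × [0, T)` with
datum `u₀ - V` and the force `(t, y) ↦ f (y + [t(W + V)])` (U. Frisch, *Turbulence* (1995), §2.2;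
weak formulation of Temam, Ch. III §1.1, tested with the transported field `ψ(t, · - [tV])`; the tree's
`Torus.IsWeakNSSolutionForcedOn.galilean_unboost` is the case `W = 0`). [cite: Frisch1995, §2.2] -/
theorem isWeakNSSolutionForcedOn_galilean_swept
    {T ν : ℝ} {f : UnitAddTorus d → EuclideanSpace ℝ d} {u₀ : UnitAddTorus d → EuclideanSpace ℝ d}
    {u : ℝ → UnitAddTorus d → EuclideanSpace ℝ d} (W : EuclideanSpace ℝ d)
    (hu : Torus.IsWeakNSSolutionForcedOn T ν (fun t y => f (y + proj (t • W))) u₀ u)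
    (hf : IsSmooth f) (hu₀ : Integrable u₀ volume) (V : EuclideanSpace ℝ d) :
    Torus.IsWeakNSSolutionForcedOn T ν (fun t y => f (y + proj (t • (W + V)))) (fun y => u₀ y - V)
      (fun t y => u t (y + proj (t • V)) - V) := by
  obtain ⟨hm, h2, hdivae, hweak⟩ := hu
  have hae2 := ae_memLp_two_slice_of_lintegral hm h2
  refine ⟨aestronglyMeasurable_stLift_comp_add_proj_smul hm V,
    lintegral_enorm_sq_comp_add_proj_smul_lt_top h2 V, ?_, fun ψ hψ hdiv => ?_⟩
  · -- weak incompressibility of a.e. slice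
    filter_upwards [hdivae, hae2] with t hdt ht
    exact isWeaklyDivFree_comp_add_right_sub_const hdt (ht.integrable one_le_two) _ V
  · -- the weak identity: test `u` with the transported field `ψ' t x = ψ t (x - [tV])`
    obtain ⟨ψ', hψ'def⟩ : ∃ ψ' : ℝ → UnitAddTorus d → EuclideanSpace ℝ d,
        ψ' = fun s z => ψ s (z - proj (s • V)) := ⟨_, rfl⟩
    have hψ' : IsSpaceTimeTest T ψ' := hψ'def ▸ isSpaceTimeTest_comp_sub_proj_smul hψ V
    have hdiv' : IsDivFreeTest ψ' := hψ'def ▸ isDivFreeTest_comp_sub_proj_smul hdiv V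
    have hψ'0 : ψ' 0 = ψ 0 := by
      rw [hψ'def]
      exact comp_sub_proj_smul_zero ψ V
    have hψ't : ∀ t x, ψ' t x = ψ t (x - proj (t • V)) := fun t x => by rw [hψ'def]
    have hψ'dt : ∀ t x, Torus.timeDeriv ψ' t x =
        Torus.timeDeriv ψ t (x - proj (t • V)) - Torus.fderiv (ψ t) (x - proj (t • V)) V := fun t x => by
      rw [hψ'def]
      exact timeDeriv_comp_sub_proj_smul hψ.1 V t x
    have hψ'D : ∀ t x, Torus.fderiv (ψ' t) x = Torus.fderiv (ψ t) (x - proj (t • V)) := fun t x => by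
      rw [hψ'def]
      exact fderiv_comp_sub (ψ t) _ x
    have hψ'L : ∀ t x, Torus.laplacian (ψ' t) x = Torus.laplacian (ψ t) (x - proj (t • V)) := fun t x => by
      rw [hψ'def]
      exact laplacian_comp_sub (ψ t) _ x
    have hid := hweak ψ' hψ' hdiv'
    rw [hψ'0] at hid
    -- the swept force: smooth slices, continuous lift, finite mass
    have hfs : ∀ (U : EuclideanSpace ℝ d) (t : ℝ), IsSmooth (fun x => f (x + proj (t • U))) :=
      fun U t => hf.comp_add_right _
    have hFm : AEStronglyMeasurable (stLift fun t x => f (x + proj (t • W)))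
        (volume.restrict (Ioo 0 T ×ˢ (univ : Set (EuclideanSpace ℝ d)))) :=
      aestronglyMeasurable_stLift_swept hf.continuous W _
    have hF2 := lintegral_Ioo_lintegral_enorm_sq_swept_lt_top (hf.memLp 2) W T
    -- integrability in time of the functional of `u` against `ψ'`
    have hΦu : IntegrableOn (fun t => ∫ x, (⟪u t x, Torus.timeDeriv ψ' t x⟫ +
        ⟪u t x, Torus.convect (u t) (ψ' t) x⟫ + ν * ⟪u t x, Torus.laplacian (ψ' t) x⟫ +
        ⟪f (x + proj (t • W)), ψ' t x⟫)) (Ioo 0 T) := by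
      obtain ⟨Kq, hKq⟩ := hψ'.exists_bound (isCompact_Icc (a := 0) (b := T))
      have hGi : IntegrableOn (fun t => ∫ x, ⟪f (x + proj (t • W)), ψ' t x⟫) (Ioo 0 T) :=
        integrableOn_integral_inner_of_lintegral (U := fun t x => f (x + proj (t • W))) hFm hF2
          hψ'.continuous_uncurry (fun t ht x => hKq t (Ioo_subset_Icc_self ht) x)
      refine ((integrableOn_nsWeakFunctional (ν := ν) hm h2 hψ').add hGi).congr_fun_ae ?_
      filter_upwards [hae2] with t ht
      have hi : Integrable (u t) volume := ht.integrable one_le_two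
      have i1 : Integrable (fun x => ⟪u t x, Torus.timeDeriv ψ' t x⟫ +
          ⟪u t x, Torus.convect (u t) (ψ' t) x⟫ + ν * ⟪u t x, Torus.laplacian (ψ' t) x⟫) volume :=
        ((integrable_inner_of_continuous hi (hψ'.timeDeriv.isSmooth_slice t).continuous).add
          (integrable_inner_convect_slice hψ' ht)).add
          ((integrable_inner_of_continuous hi (hψ'.isSmooth_slice t).laplacian.continuous).const_mul ν)
      have i2 : Integrable (fun x => ⟪f (x + proj (t • W)), ψ' t x⟫) volume :=
        integrable_inner_of_continuous (hfs W t).integrable (hψ'.isSmooth_slice t).continuous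
      exact (integral_add i1 i2).symm
    -- integrability in time of the frame functional `t ↦ ∫ ⟪V, ∂ₜψ t⟫`
    have hC : IntegrableOn (fun t => ∫ y, ⟪V, Torus.timeDeriv ψ t y⟫) (Ioo 0 T) := by
      obtain ⟨Kp, hKp⟩ := hψ.exists_bound_timeDeriv (isCompact_Icc (a := 0) (b := T))
      exact integrableOn_integral_inner_of_lintegral (U := fun (_ : ℝ) (_ : UnitAddTorus d) => V)
        (aestronglyMeasurable_stLift_const (isSmooth_const V) _)
        (lintegral_enorm_sq_const_lt_top (isSmooth_const V) _) hψ.timeDeriv.continuous_uncurry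
        (fun t ht x => hKp t (Ioo_subset_Icc_self ht) x)
    -- the slice identity at a.e. time
    have hWV : ∀ (t : ℝ) (y : UnitAddTorus d),
        f (y + proj (t • V) + proj (t • W)) = f (y + proj (t • (W + V))) :=
      fun t y => comp_add_proj_smul_add_proj_smul f W V t y
    have hslice : ∀ᵐ t ∂(volume.restrict (Ioo 0 T)),
        ∫ y, (⟪u t (y + proj (t • V)) - V, Torus.timeDeriv ψ t y⟫ +
          ⟪u t (y + proj (t • V)) - V, Torus.convect (fun z => u t (z + proj (t • V)) - V) (ψ t) y⟫ +
          ν * ⟪u t (y + proj (t • V)) - V, Torus.laplacian (ψ t) y⟫ +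
          ⟪f (y + proj (t • (W + V))), ψ t y⟫) =
        (∫ x, (⟪u t x, Torus.timeDeriv ψ' t x⟫ + ⟪u t x, Torus.convect (u t) (ψ' t) x⟫ +
          ν * ⟪u t x, Torus.laplacian (ψ' t) x⟫ + ⟪f (x + proj (t • W)), ψ' t x⟫)) -
          ∫ y, ⟪V, Torus.timeDeriv ψ t y⟫ := by
      filter_upwards [hae2, hdivae] with t ht hdt
      have hw : MemLp (fun y => u t (y + proj (t • V))) 2 volume :=
        ht.comp_measurePreserving (measurePreserving_add_right volume (proj (t • V)))
      have hwdiv : Torus.IsWeaklyDivFree (fun y => u t (y + proj (t • V))) := by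
        simpa only [sub_zero] using
          isWeaklyDivFree_comp_add_right_sub_const hdt (ht.integrable one_le_two) (proj (t • V)) 0
      have key := integral_galilean_slice hw hwdiv (hfs (W + V) t) (hψ.isSmooth_slice t)
        (hψ.timeDeriv.isSmooth_slice t) ν V
      have hcv : ∫ x, (⟪u t x, Torus.timeDeriv ψ' t x⟫ + ⟪u t x, Torus.convect (u t) (ψ' t) x⟫ +
          ν * ⟪u t x, Torus.laplacian (ψ' t) x⟫ + ⟪f (x + proj (t • W)), ψ' t x⟫) =
          ∫ y, (⟪u t (y + proj (t • V)), Torus.timeDeriv ψ t y - Torus.fderiv (ψ t) y V⟫ +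
            ⟪u t (y + proj (t • V)), Torus.convect (fun z => u t (z + proj (t • V))) (ψ t) y⟫ +
            ν * ⟪u t (y + proj (t • V)), Torus.laplacian (ψ t) y⟫ +
            ⟪f (y + proj (t • (W + V))), ψ t y⟫) := by
        rw [← integral_add_right_eq_self (fun x => ⟪u t x, Torus.timeDeriv ψ' t x⟫ +
          ⟪u t x, Torus.convect (u t) (ψ' t) x⟫ + ν * ⟪u t x, Torus.laplacian (ψ' t) x⟫ +
          ⟪f (x + proj (t • W)), ψ' t x⟫) (proj (t • V))]
        refine integral_congr_ae (ae_of_all _ fun y => ?_)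
        simp only [Torus.convect, hψ't, hψ'dt, hψ'D, hψ'L, add_sub_cancel_right, hWV]
      rw [hcv]
      exact key
    -- the datum
    have hdat : ∫ y, ⟪u₀ y - V, ψ 0 y⟫ = (∫ y, ⟪u₀ y, ψ 0 y⟫) - ∫ y, ⟪V, ψ 0 y⟫ := by
      rw [← integral_sub (integrable_inner_of_continuous hu₀ (hψ.isSmooth_slice 0).continuous)
        (integrable_inner_of_continuous (integrable_const V) (hψ.isSmooth_slice 0).continuous)]
      simp only [inner_sub_left]
    rw [integral_congr_ae hslice, integral_sub hΦu hC, setIntegral_integral_inner_timeDeriv_const hψ V,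
      hdat]
    linarith

end Summit.AnomalousDissipation.AnomalousDissipation.Theorems

end
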